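import Mathlib

/-!
# The U-local fibre statement of typed BHK 1.4 FAILS — a kernel certificate
(blind cell PercRepro2, seat mine-c, 2026-08-25; row 2′ULOC / (UDOM), CONJECTURES v2.99jk line 53)

Setting (rows 2′TB / 2′ULOC, the folded form of `TB14Fold`): one colouring `x` of the edges of a finite
graph — red = the first copy, blue = the second copy (its complement); `S, S′` = the red / blue cluster of
`a₁`, `T, T′` = those of `a₂`; `P = {a₂ ∉ S ∪ S′}` (= `a₁ ↮ a₂` in both colours).  Typed BHK 1.4 for
single-vertex events (row 2′TB) at the all-free profile is

  `(TB14)_sv :  D := Σ_{x ∈ P, b ∈ S} ([o ∈ T′] − [o ∈ T]) ≥ 0`.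

Row 2′ULOC (i) (p5 g2, 2026-08-25T04:32Z) asserts that `D` is nonnegative on EVERY fibre of
`U := S ∪ S′`: `D_U := Σ_{x ∈ P, b ∈ S, S ∪ S′ = U} ([o ∈ T′] − [o ∈ T]) ≥ 0` for all `U`
(the inside-`U` bijection statement (UDOM) implies it).  This file checks in the kernel that it FAILS:

on the graph `c6_00017 + a₂` (vertices `0..6`, edges `{0,5}, {1,5}, {2,3}, {2,4}, {3,5}, {4,5}, {4,6}`),
`a₁ = 2`, `a₂ = 6`, `b = 3`, `o = 4`, all edges free (uniform colouring):

  `#{x ∈ P : b ∈ S, o ∈ T′} = 20`, `#{x ∈ P : b ∈ S, o ∈ T} = 12`, so `D = 8 ≥ 0` (the row 2′TB holds),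

  but on the fibre `U = {0,1,2,3,4,5} = V ∖ {a₂}`:
  `#{… , o ∈ T′, S ∪ S′ = U} = 4`, `#{… , o ∈ T, S ∪ S′ = U} = 5`, so `D_U = −1 < 0`.

(The five negative configurations have `2–3` red, `2–4` blue and the hub `5` both-coloured with its two
unmarked leaves `0, 1` free; the leaves are global spectators — `pairCount_fold_spectatorLeaf` — but not
fibre-wise ones.)  The four counts are established by `decide` (kernel evaluation, standard axioms only).
Re-derived exactly by two independent evaluators (session work/fibres.py, work/neg_uloc_twin.py).
-/

namespace Summit.Ventures.PercRepro2.ULocCounterexample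

/-- The seven edges of `c6_00017 + a₂` (vertices `0..6`), as pairs. -/
def edge : Nat → Nat × Nat
  | 0 => (0, 5)
  | 1 => (1, 5)
  | 2 => (2, 3)
  | 3 => (2, 4)
  | 4 => (3, 5)
  | 5 => (4, 5)
  | _ => (4, 6)

/-- The root `a₁ = 2`. -/
def a1 : Nat := 2
/-- The root `a₂ = 6`. -/
def a2 : Nat := 6
/-- The mark `b = 3` (the event `A = {b ∈ S}`). -/
def b : Nat := 3
/-- The mark `o = 4` (the events `B = {o ∈ T}`, `B̄ = {o ∈ T′}`). -/
def o : Nat := 4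

/-- Edge `i` is RED in the colouring `c ∈ [0, 2^7)` iff bit `i` of `c` is set (blue otherwise). -/
def isRed (c i : Nat) : Bool := c.testBit i

/-- Vertex sets are bitmasks over `0..6`; `mem S x` is `x ∈ S`. -/
def mem (S x : Nat) : Bool := S.testBit x

/-- One expansion step of a vertex set along the edges of colour `col` (`true` = red, `false` = blue). -/
def step (col : Bool) (c S : Nat) : Nat :=
  (List.range 7).foldl (fun S i =>
    let e := edge i
    if isRed c i == col then
      if mem S e.1 || mem S e.2 then S ||| (1 <<< e.1) ||| (1 <<< e.2) else S
    else S) S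

/-- `n`-fold iteration. -/
def iter (f : Nat → Nat) : Nat → Nat → Nat
  | 0, S => S
  | n + 1, S => iter f n (f S)

/-- The cluster of `v` in the colour `col` (seven steps suffice on seven vertices). -/
def reach (col : Bool) (c v : Nat) : Nat := iter (step col c) 7 (1 <<< v)

/-- `S = C_red(a₁)`. -/
def S (c : Nat) : Nat := reach true c a1
/-- `S′ = C_blue(a₁)`. -/
def S' (c : Nat) : Nat := reach false c a1
/-- `T = C_red(a₂)`. -/
def T (c : Nat) : Nat := reach true c a2
/-- `T′ = C_blue(a₂)`. -/
def T' (c : Nat) : Nat := reach false c a2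

/-- `P = {a₂ ∉ S ∪ S′}` (`a₁ ↮ a₂` in both colours). -/
def P (c : Nat) : Bool := !(mem (S c ||| S' c) a2)
/-- `A = {b ∈ S}`. -/
def A (c : Nat) : Bool := mem (S c) b
/-- `B = {o ∈ T}`. -/
def B (c : Nat) : Bool := mem (T c) o
/-- `B̄ = {o ∈ T′}` (the event `B` in the second copy). -/
def Bbar (c : Nat) : Bool := mem (T' c) o
/-- The fibre `U = S ∪ S′ = {0,1,2,3,4,5}` (bitmask `63`). -/
def inU (c : Nat) : Bool := (S c ||| S' c) == 63

/-- `#{c < 2^7 : F c}`. -/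
def count (F : Nat → Bool) : Nat :=
  (List.range 128).foldl (fun acc c => if F c then acc + 1 else acc) 0

/-- Sanity: `|P| = 56`. -/
theorem P_card : count P = 56 := by decide +kernel

/-! ### The four counts (kernel evaluation). -/

/-- `#{x ∈ P : b ∈ S, o ∈ T′} = 20`. -/
theorem plus_eq : count (fun c => P c && A c && Bbar c) = 20 := by decide +kernel
/-- `#{x ∈ P : b ∈ S, o ∈ T} = 12`. -/
theorem minus_eq : count (fun c => P c && A c && B c) = 12 := by decide +kernel
/-- `#{x ∈ P : b ∈ S, o ∈ T′, S ∪ S′ = U} = 4`. -/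
theorem plusU_eq : count (fun c => P c && A c && Bbar c && inU c) = 4 := by decide +kernel
/-- `#{x ∈ P : b ∈ S, o ∈ T, S ∪ S′ = U} = 5`. -/
theorem minusU_eq : count (fun c => P c && A c && B c && inU c) = 5 := by decide +kernel

/-- The (TB14)_sv slack of the instance: `D = 20 − 12 = 8`. -/
def D : ℤ := (count (fun c => P c && A c && Bbar c) : ℤ) - count (fun c => P c && A c && B c)
/-- The `U`-fibre slack on `U = V ∖ {a₂}`: `D_U = 4 − 5 = −1`. -/
def DU : ℤ := (count (fun c => P c && A c && Bbar c && inU c) : ℤ) -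
  count (fun c => P c && A c && B c && inU c)

/-- Row 2′TB holds on the instance: `D = 8`. -/
theorem D_eq : D = 8 := by unfold D; rw [plus_eq, minus_eq]; norm_num
/-- `D ≥ 0`. -/
theorem tb14_holds : 0 ≤ D := by rw [D_eq]; norm_num

/-- **The U-fibre slack is negative**: `D_U = −1`. -/
theorem DU_eq : DU = -1 := by unfold DU; rw [plusU_eq, minusU_eq]; norm_num
/-- Row 2′ULOC (i) FAILS on the fibre `U = {0,…,5}` of this instance (hence (UDOM) fails as well). -/
theorem uloc_fails : DU < 0 := by rw [DU_eq]; norm_num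

end Summit.Ventures.PercRepro2.ULocCounterexample
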